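import Summits.HodgeConjecture.HodgeConjecture.Theorems.Ring2AbelianAllAndreInvariantHomNumDivision
import HarnessLib

/-!
# Ring 2 · sub-cell AbelianAll (ALL ABELIAN VARIETIES), André axis, part XXX-c — THE ATOMS: every numerical hypothesis of the
# André axis is THE LIFT plus ONE EQUALITY in the chain `j_t^* N^q(𝒳) ⊆ N^q_inv ⊆ Π^q ⊆ B^q` of invariant subspaces of the fibre;
# `(Num_t)(p,q) ⟺ (L)_t(p) ∧ (InvProj)_t(q)`, `(Num₂)(t,q) ⟺ (L)_t(p) ∧ (FibAlg)_t(q)`, `Num^CM ⟺ (L) ∧ InvProj^CM` — all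
# unconditional, by a dimension count over part XXX-a's duality `dim N^p_inv = dim N^q_inv`

HONEST FRAMING (page 1, verbatim): **research route, not a corollary; conditional on HC_CM plus one named
minimal statement.** Cell line: research route conditional on HC_CM; not a corollary; Q11.4-sentence-2
already refuted in dim ≥ 3. Nothing in this file proves a case of the Hodge conjecture for an abelian variety;
`HC_CM` (`Theses.RankFourFaces.CMAbelianHodge`) does not occur in this file; item `Theses.RankFourFaces.CMToAbelian`
(stmt-HodgeConjecture-16267) OPEN and not closed here. Seat `pub-hodge-ring2-ab-andre-2`, gen 22; brief (ii) "record each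
version; prove the implications between them". Sequel of parts XXX-a/b (`Ring2AbelianAllAndreInvariantHomNum[Division]`).

## The chain at a point `t` of a compact pencil `f : 𝒳 ⟶ S` of abelian `d`-folds, degree `2q` (`I_q = Im j_t^*`, `p + q = d`)

  `A^q := j_t^* N^q(𝒳)  ⊆  N^q_inv := N^q(X_t) ∩ I_q  ⊆  Π^q := {y ∈ I_q : j_{t*} y ∈ j_{t*} N^q(X_t)}  ⊆  B^q := {y ∈ I_q : j_{t*} y ∈ N^{q+1}(𝒳)}`

(`Π^q` = the invariant projections of the algebraic classes of the fibre along `H(X_t) = I_q ⊕ ker j_{t*}`, part XXVII-b; `B^q` = the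
invariant classes with algebraic fibre-class multiple.) THE ATOMS: (L)_t(q) `A^q = N^q_inv`; **(InvProj)_t(q)** `N^q_inv = Π^q` — "every
algebraic class of the fibre is Gysin-equivalent to an INVARIANT algebraic class"; **(FibAlg)_t(q)** `N^q_inv = B^q` — "an invariant class
whose fibre-class multiple `x ∪ [X_t]` is algebraic on `𝒳` is algebraic on `X_t`" (⟹ (InvProj)_t(q)). At a fibre satisfying `HC^q` both
atoms hold (all four spaces lie in the Hodge span, parts XXIX-g/h).

## THE DIMENSION COUNT (§2)

Part XXX-a: `N^p_inv × N^q_inv` is non-degenerate, so `dim N^p_inv = dim N^q_inv`. If `N^q_inv ⊆ V` and `V ∩ (A^p)^⊥ = 0` then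
`dim N^q_inv ≤ dim V ≤ dim A^p ≤ dim N^p_inv = dim N^q_inv`: ALL EQUAL, i.e. **(L)_t(p) holds AND `V = N^q_inv`** (`sandwich`). Each
numerical hypothesis says `V ∩ (A^p)^⊥ = 0` for one `V` of the chain: (Num_t)^{inv}(p,q) for `V = N^q_inv` (part XXX-a), (Num_t)(p,q) for
`V = Π^q`, (Num₂)(t,q) for `V = B^q`. Hence (§3–§5, all `⟺`, all unconditional, every point of every compact abelian pencil):

* **`(Num_t)(p,q) ⟺ (L)_t(p) ∧ (InvProj)_t(q)`** (`numerical_iff_comap_le_sup_and_invProj`);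
* **`(Num₂)(t,q) ⟺ (L)_t(p) ∧ (FibAlg)_t(q)`** (`numerical₂_iff_comap_le_sup_and_fibAlg`) — note the CROSS degree: hom ≡ num for
  the fibre-class multiples in degree `2q+2` gives the LIFT in the complementary degree `2p`;
* (part XXX-d: `Div[t,q] ⟺ (L)_t(q) ∧ (FibAlg)_t(q)`, elementary, and the rank form of the lift);
* so `(Num₂)(t,q) ⟹ (Num_t)(p,q) ⟹ (L)_t(p)`, and the node identity **`Num^CM ⟺ (L) ∧ InvProj^CM`**
  (`cmPointedPencilNumerical_iff_lift_and_invProjCM`): the EXACT surplus of part XVIII-c's numerical node over the lift node is "at CM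
  fibres, invariant projections of algebraic classes are algebraic".

## What is proved (theorems only; no definition, no named fact, no sorry; brackets are `local notation3`)

§1 `finrank_le_of_forall_orthogonal_eq_zero`, `finrank_eq_of_nondegenerate` (linear algebra); §2 `finrank_inf_range_eq` (`dim N^p_inv =
dim N^q_inv`), `comap_le_sup_of_map_eq_inf_range`, **`sandwich`**; §3 `exists_mem_range_fiberGysin_eq`, **`numerical_iff_comap_le_sup_and_invProj`**,
`comap_le_sup_of_numerical'` (second proof of part XVIII-a's row, through the invariant part); §4 **`numerical₂_iff_comap_le_sup_and_fibAlg`**,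
`comap_le_sup_of_numerical₂` ((Num₂)(t,q) ⟹ (L)_t(d-q)), `invProj_of_fibAlg`, `numerical_of_numerical₂`;
§5 **`cmPointedPencilNumerical_iff_lift_and_invProjCM`**.

References: Lieberman1968 (main theorem); Kleiman1968AlgebraicCycles (§3 Prop. 3.8, Cor. 3.9 (D(X))); Milne2020HodgeClassesAV (Prop. 1 p. 7);
Andre1996Motifs (§5.1, §6.3 Remarque 2); DeligneHodgeII1971 (Thm. 4.1.1); VoisinHodgeII2003 (§4.3.1 Thm. 4.18, §4.3.3 Cor. 4.25);
FultonYoungTableaux1997 (App. B §B.1 (6)); HatcherAT2002 (§3.3 Prop. 3.38).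
-/

noncomputable section

set_option linter.dupNamespace false

namespace Summit.HodgeConjecture.HodgeConjecture.Ring2.AbelianAll

open CategoryTheory AlgebraicGeometry
open Literature.AlgebraicGeometry Literature.AlgebraicGeometry.Motives
open Literature.AlgebraicGeometry.HodgeTheory
open Literature.AlgebraicTopology.SingularHomology (singularCohomology cupProduct cupProduct_gradedComm_holds)
open Literature.AlgebraicGeometry.Deligne1982 (cmLocus)
open Summit.HodgeConjecture.HodgeConjecture.Theses

/-! ## §1 Linear algebra: orthogonality bounds the dimension -/

section LinAlg

variable {K : Type*} [Field K] {M N L : Type*} [AddCommGroup M] [Module K M] [AddCommGroup N] [Module K N]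
  [AddCommGroup L] [Module K L]

/-- **If `V` meets the orthogonal of `A` trivially then `dim V ≤ dim A`** (for a bilinear pairing with values in a line `L`):
`v ↦ B(·, v)|_A` embeds `V` into the dual of `A`. [folklore] -/
theorem finrank_le_of_forall_orthogonal_eq_zero (B : M →ₗ[K] N →ₗ[K] L) (hL : Module.finrank K L = 1)
    {A : Submodule K M} {V : Submodule K N} [FiniteDimensional K A] [FiniteDimensional K V]
    (h : ∀ v ∈ V, (∀ a ∈ A, B a v = 0) → v = 0) : Module.finrank K V ≤ Module.finrank K A := by
  haveI : FiniteDimensional K L := Module.finite_of_finrank_eq_succ hL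
  let ℓ : L ≃ₗ[K] K := LinearEquiv.ofFinrankEq L K (by rw [hL, Module.finrank_self])
  let φ : V →ₗ[K] Module.Dual K A := ((B.domRestrict₁₂ A V).flip).compr₂ ℓ.toLinearMap
  have hφ : Function.Injective φ := by
    intro v₁ v₂ hv
    have h0 : φ (v₁ - v₂) = 0 := by rw [map_sub, hv, sub_self]
    have key : ((v₁ - v₂ : V) : N) = 0 := h _ (v₁ - v₂).2 fun a ha ↦ by
      have := LinearMap.congr_fun h0 ⟨a, ha⟩
      change ℓ (B a ((v₁ - v₂ : V) : N)) = 0 at this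
      exact ℓ.map_eq_zero_iff.1 this
    exact sub_eq_zero.1 (Subtype.ext key)
  rw [← Subspace.dual_finrank_eq (K := K) (V := A)]
  exact LinearMap.finrank_le_finrank_of_injective hφ

/-- **A pairing non-degenerate on both sides between finite-dimensional subspaces forces equal dimensions.** [folklore] -/
theorem finrank_eq_of_nondegenerate (B : M →ₗ[K] N →ₗ[K] L) (hL : Module.finrank K L = 1)
    {A : Submodule K M} {V : Submodule K N} [FiniteDimensional K A] [FiniteDimensional K V]
    (h₁ : ∀ a ∈ A, (∀ v ∈ V, B a v = 0) → a = 0) (h₂ : ∀ v ∈ V, (∀ a ∈ A, B a v = 0) → v = 0) :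
    Module.finrank K A = Module.finrank K V :=
  le_antisymm (finrank_le_of_forall_orthogonal_eq_zero B.flip hL (A := V) (V := A) fun a ha hav ↦ h₁ a ha hav)
    (finrank_le_of_forall_orthogonal_eq_zero B hL h₂)

end LinAlg

variable {𝒳 S : SchemeOver ℂ} {d : ℕ} {f : 𝒳 ⟶ S}

/-- **(FibAlg) `FibAlg[hf, t, q]` — "an invariant class whose fibre-class multiple is algebraic on `𝒳` is algebraic on the fibre"**:
`L_t⁻¹ N^{q+1}(𝒳) ≤ (j_t^*)⁻¹ N^q(X_t)`, i.e. `B^q = N^q_inv`. Display-only; a HYPOTHESIS wherever it occurs; automatic at a fibre satisfying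
`HC^q` (such classes are Hodge classes of the fibre, parts XXIX-g/h). [cite: Kleiman1968AlgebraicCycles, §3 (D(X))] -/
local notation3 "FibAlg[" hf ", " t ", " q "]" =>
  Submodule.comap ((fiberGysin hf t q) ∘ₗ (complexBetti.map (fiberι f t) (2 * q)).hom) (algebraicClasses 𝒳 (q + 1)) ≤
    (algebraicClasses (fiberOver f t) q).comap (complexBetti.map (fiberι f t) (2 * q)).hom

/-- **(InvProj) `InvProj[hf, t, q]` — "every algebraic class of the fibre is Gysin-equivalent to an INVARIANT algebraic class"**
(`Π^q = N^q_inv`: the projection of `N^q(X_t)` to `Im j_t^*` along `ker j_{t*}` stays inside `N^q(X_t)`). Display-only; a HYPOTHESIS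
wherever it occurs; automatic at a fibre satisfying `HC^q`. [cite: DeligneHodgeII1971, Thm. 4.1.1] [cite: VoisinHodgeII2003, §4.3.3 Cor. 4.25] -/
local notation3 "InvProj[" hf ", " t ", " q "]" =>
  ∀ b ∈ algebraicClasses (fiberOver f t) q,
    ∃ b' ∈ algebraicClasses (fiberOver f t) q ⊓ LinearMap.range (complexBetti.map (fiberι f t) (2 * q)).hom,
      fiberGysin hf t q b' = fiberGysin hf t q b

/-! ## §2 `dim N^p_inv = dim N^q_inv` and the sandwich -/

/-- **`dim (N^p(X_t) ∩ Im j_t^*) = dim (N^q(X_t) ∩ Im j_t^*)` for `p + q = d`** (part XXX-a's two-sided non-degeneracy).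
[cite: Lieberman1968, main theorem] [cite: Kleiman1968AlgebraicCycles, §3] -/
theorem finrank_inf_range_eq (hf : IsCompactAbelianPencil f d) (t : ComplexPoints S) {p q : ℕ} (hpq : p + q = d) :
    Module.finrank ℂ ↥(algebraicClasses (fiberOver f t) p ⊓ LinearMap.range (complexBetti.map (fiberι f t) (2 * p)).hom) =
      Module.finrank ℂ ↥(algebraicClasses (fiberOver f t) q ⊓ LinearMap.range (complexBetti.map (fiberι f t) (2 * q)).hom) := by
  have hXt := hf.isSmoothProjective_fiberOver t
  haveI := finite_complexBetti hXt (2 * p)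
  haveI := finite_complexBetti hXt (2 * q)
  obtain ⟨h₁, h₂⟩ := nondegenerate_invariant_fiberOver hf t hpq
  exact finrank_eq_of_nondegenerate (cupProduct (show 2 * p + 2 * q = 2 * d by omega))
    (finrank_complexBetti_two_mul_eq_one hXt) h₁ h₂

/-- `(L)_t(p) ⟸ j_t^* N^p(𝒳) = N^p(X_t) ∩ Im j_t^*` (converse of part XXX-a's `inf_range_eq_map_of_comap_le_sup`).
[cite: Milne2020HodgeClassesAV, Prop. 1 (p. 7)] -/
theorem comap_le_sup_of_map_eq_inf_range (t : ComplexPoints S) (p : ℕ)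
    (h : (algebraicClasses 𝒳 p).map (complexBetti.map (fiberι f t) (2 * p)).hom =
      algebraicClasses (fiberOver f t) p ⊓ LinearMap.range (complexBetti.map (fiberι f t) (2 * p)).hom) :
    (algebraicClasses (fiberOver f t) p).comap (complexBetti.map (fiberι f t) (2 * p)).hom ≤
      algebraicClasses 𝒳 p ⊔ LinearMap.ker (complexBetti.map (fiberι f t) (2 * p)).hom := by
  intro W hW
  have hW' : complexBetti.map (fiberι f t) (2 * p) W ∈
      algebraicClasses (fiberOver f t) p ⊓ LinearMap.range (complexBetti.map (fiberι f t) (2 * p)).hom := ⟨hW, ⟨W, rfl⟩⟩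
  rw [← h] at hW'
  obtain ⟨a, ha, haW⟩ := hW'
  rw [show W = a + (W - a) by abel]
  refine Submodule.add_mem_sup ha ?_
  rw [LinearMap.mem_ker, map_sub, sub_eq_zero]
  exact haW.symm

/-- **THE SANDWICH.** Let `p + q = d` and `V ≤ H^{2q}(X_t)` contain the invariant algebraic classes `N^q(X_t) ∩ Im j_t^*`. If every
`v ∈ V` cup-orthogonal to the restricted global algebraic classes `j_t^* N^p(𝒳)` vanishes, then (L)_t(p) holds AND `V = N^q(X_t) ∩ Im j_t^*`:
`dim N^q_inv ≤ dim V ≤ dim j_t^*N^p(𝒳) ≤ dim N^p_inv = dim N^q_inv`. [cite: Kleiman1968AlgebraicCycles, §3 (D(X))] [cite: Lieberman1968, main theorem] -/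
theorem sandwich (hf : IsCompactAbelianPencil f d) (t : ComplexPoints S) {p q : ℕ} (hpq : p + q = d)
    {V : Submodule ℂ (complexBetti (fiberOver f t) (2 * q))}
    (hNV : algebraicClasses (fiberOver f t) q ⊓ LinearMap.range (complexBetti.map (fiberι f t) (2 * q)).hom ≤ V)
    (hV : ∀ v ∈ V, (∀ a ∈ algebraicClasses 𝒳 p,
      cupProduct (show 2 * p + 2 * q = 2 * d by omega) (complexBetti.map (fiberι f t) (2 * p) a) v = 0) → v = 0) :
    ((algebraicClasses (fiberOver f t) p).comap (complexBetti.map (fiberι f t) (2 * p)).hom ≤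
        algebraicClasses 𝒳 p ⊔ LinearMap.ker (complexBetti.map (fiberι f t) (2 * p)).hom) ∧
      V = algebraicClasses (fiberOver f t) q ⊓ LinearMap.range (complexBetti.map (fiberι f t) (2 * q)).hom := by
  have hXt := hf.isSmoothProjective_fiberOver t
  haveI := finite_complexBetti hXt (2 * p)
  haveI := finite_complexBetti hXt (2 * q)
  have hA : (algebraicClasses 𝒳 p).map (complexBetti.map (fiberι f t) (2 * p)).hom ≤
      algebraicClasses (fiberOver f t) p ⊓ LinearMap.range (complexBetti.map (fiberι f t) (2 * p)).hom :=
    map_algebraicClasses_le_inf_range hf t p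
  have h1 : Module.finrank ℂ V ≤
      Module.finrank ℂ ↥((algebraicClasses 𝒳 p).map (complexBetti.map (fiberι f t) (2 * p)).hom) :=
    finrank_le_of_forall_orthogonal_eq_zero (cupProduct (show 2 * p + 2 * q = 2 * d by omega))
      (finrank_complexBetti_two_mul_eq_one hXt)
      (A := (algebraicClasses 𝒳 p).map (complexBetti.map (fiberι f t) (2 * p)).hom) (V := V)
      fun v hv hav ↦ hV v hv fun a ha ↦ hav _ (Submodule.mem_map_of_mem ha)
  have h2 := Submodule.finrank_mono hA
  have h3 := finrank_inf_range_eq hf t hpq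
  have h4 := Submodule.finrank_mono hNV
  refine ⟨comap_le_sup_of_map_eq_inf_range t p (Submodule.eq_of_le_of_finrank_eq hA (by omega)),
    (Submodule.eq_of_le_of_finrank_eq hNV (by omega)).symm⟩

/-! ## §3 `(Num_t)(p,q) ⟺ (L)_t(p) ∧ (InvProj)_t(q)` -/

/-- Every class of the fibre is Gysin-equivalent to an invariant class: `H^{2q}(X_t) = Im j_t^* ⊕ ker j_{t*}` (part XXVII-b).
[cite: VoisinHodgeII2003, §4.3.3 Cor. 4.25] [cite: DeligneHodgeII1971, Thm. 4.1.1] -/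
theorem exists_mem_range_fiberGysin_eq (hf : IsCompactAbelianPencil f d) (t : ComplexPoints S) (q : ℕ)
    (b : complexBetti (fiberOver f t) (2 * q)) :
    ∃ x : complexBetti 𝒳 (2 * q),
      fiberGysin hf t q (complexBetti.map (fiberι f t) (2 * q) x) = fiberGysin hf t q b := by
  have hc : IsCompl (LinearMap.range (complexBetti.map (fiberι f t) (2 * q)).hom) (LinearMap.ker (fiberGysin hf t q)) :=
    isCompl_range_map_fiberι_ker_complexGysin hf.isSmoothProjective_base hf.isSmoothProjectiveFamily
      hf.isSmoothProjective_total (show 2 * q + 2 * (d + 1) = 2 * (q + 1) + 2 * d by ring) t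
  have hbmem : b ∈ LinearMap.range (complexBetti.map (fiberι f t) (2 * q)).hom ⊔ LinearMap.ker (fiberGysin hf t q) := by
    rw [hc.sup_eq_top]
    exact Submodule.mem_top
  obtain ⟨y, ⟨x, hxy⟩, k, hk, hyk⟩ := Submodule.mem_sup.1 hbmem
  rw [LinearMap.mem_ker] at hk
  refine ⟨x, ?_⟩
  have hxy' : complexBetti.map (fiberι f t) (2 * q) x = y := hxy
  rw [hxy', ← hyk, map_add, hk, add_zero]

/-- **`(Num_t)(p,q) ⟺ (L)_t(p) ∧ (InvProj)_t(q)`**, unconditionally (`p + q = d`): part XVIII's full numerical hypothesis IS the lift in the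
complementary degree plus "every algebraic class of degree `2q` on the fibre is Gysin-equivalent to an invariant algebraic class". `⟹`:
the sandwich for `V = Π^q = {y ∈ Im j_t^* : j_{t*} y ∈ j_{t*} N^q(X_t)}`; `⟸`: part XXX-a on the invariant representative.
[cite: Kleiman1968AlgebraicCycles, §3 (D(X))] [cite: Lieberman1968, main theorem] [cite: Milne2020HodgeClassesAV, Prop. 1 (p. 7)] -/
theorem numerical_iff_comap_le_sup_and_invProj (hf : IsCompactAbelianPencil f d) (t : ComplexPoints S) {p q : ℕ}
    (hpq : p + q = d) :
    (∀ b ∈ algebraicClasses (fiberOver f t) q,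
        (∀ a ∈ algebraicClasses 𝒳 p,
          cupProduct (show 2 * p + 2 * (q + 1) = 2 * (d + 1) by omega) a (fiberGysin hf t q b) = 0) →
          fiberGysin hf t q b = 0) ↔
      ((algebraicClasses (fiberOver f t) p).comap (complexBetti.map (fiberι f t) (2 * p)).hom ≤
          algebraicClasses 𝒳 p ⊔ LinearMap.ker (complexBetti.map (fiberι f t) (2 * p)).hom) ∧ InvProj[hf, t, q] := by
  refine ⟨fun hNum ↦ ?_, fun ⟨hL, hInv⟩ b hb hab ↦ ?_⟩
  · -- the sandwich for `V = Π^q`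
    set V : Submodule ℂ (complexBetti (fiberOver f t) (2 * q)) :=
      LinearMap.range (complexBetti.map (fiberι f t) (2 * q)).hom ⊓
        ((algebraicClasses (fiberOver f t) q).map (fiberGysin hf t q)).comap (fiberGysin hf t q) with hVdef
    have hNV : algebraicClasses (fiberOver f t) q ⊓ LinearMap.range (complexBetti.map (fiberι f t) (2 * q)).hom ≤ V :=
      fun b hb ↦ ⟨hb.2, ⟨b, hb.1, rfl⟩⟩
    have hV : ∀ v ∈ V, (∀ a ∈ algebraicClasses 𝒳 p,
        cupProduct (show 2 * p + 2 * q = 2 * d by omega) (complexBetti.map (fiberι f t) (2 * p) a) v = 0) → v = 0 := by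
      rintro v ⟨⟨W, hW⟩, ⟨b, hb, hbv⟩⟩ hav
      have hW' : complexBetti.map (fiberι f t) (2 * q) W = v := hW
      have hjv : fiberGysin hf t q v = 0 := by
        rw [← hbv]
        refine hNum b hb fun a ha ↦ ?_
        rw [hbv, ← cupProduct_map_fiberι_eq_zero_iff hf t hpq a v]
        exact hav a ha
      rw [← hW'] at hjv ⊢
      exact fibreGysinKernelOn_holds hf q t t W hjv
    obtain ⟨hL, hVeq⟩ := sandwich hf t hpq hNV hV
    refine ⟨hL, fun b hb ↦ ?_⟩
    obtain ⟨x, hx⟩ := exists_mem_range_fiberGysin_eq hf t q b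
    have hxV : complexBetti.map (fiberι f t) (2 * q) x ∈ V := ⟨⟨x, rfl⟩, ⟨b, hb, hx.symm⟩⟩
    rw [hVeq] at hxV
    exact ⟨_, hxV, hx⟩
  · obtain ⟨b', hb', hbb'⟩ := hInv b hb
    rw [← hbb']
    refine numericalInv_of_comap_le_sup hf t hpq hL b' hb' fun a ha ↦ ?_
    rw [hbb']
    exact hab a ha

/-- **(Num_t)(p,q) ⟹ (L)_t(p), second proof** (through the sandwich; the tree's `comap_le_sup_of_numerical` goes through part XVIII-a).
[cite: Kleiman1968AlgebraicCycles, §3 (D(X))] [cite: Milne2020HodgeClassesAV, Prop. 1 (p. 7)] -/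
theorem comap_le_sup_of_numerical' (hf : IsCompactAbelianPencil f d) (t : ComplexPoints S) {p q : ℕ} (hpq : p + q = d)
    (hNum : ∀ b ∈ algebraicClasses (fiberOver f t) q,
      (∀ a ∈ algebraicClasses 𝒳 p,
        cupProduct (show 2 * p + 2 * (q + 1) = 2 * (d + 1) by omega) a (fiberGysin hf t q b) = 0) →
        fiberGysin hf t q b = 0) :
    (algebraicClasses (fiberOver f t) p).comap (complexBetti.map (fiberι f t) (2 * p)).hom ≤
      algebraicClasses 𝒳 p ⊔ LinearMap.ker (complexBetti.map (fiberι f t) (2 * p)).hom :=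
  ((numerical_iff_comap_le_sup_and_invProj hf t hpq).1 hNum).1

/-- **(Num_t)(p,q) ⟹ (InvProj)_t(q)**: granted part XVIII's numerical hypothesis, invariant projections of algebraic classes of degree `2q`
on the fibre are algebraic. [cite: Kleiman1968AlgebraicCycles, §3 (D(X))] -/
theorem invProj_of_numerical (hf : IsCompactAbelianPencil f d) (t : ComplexPoints S) {p q : ℕ} (hpq : p + q = d)
    (hNum : ∀ b ∈ algebraicClasses (fiberOver f t) q,
      (∀ a ∈ algebraicClasses 𝒳 p,
        cupProduct (show 2 * p + 2 * (q + 1) = 2 * (d + 1) by omega) a (fiberGysin hf t q b) = 0) →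
        fiberGysin hf t q b = 0) :
    InvProj[hf, t, q] :=
  ((numerical_iff_comap_le_sup_and_invProj hf t hpq).1 hNum).2

/-! ## §4 `(Num₂)(t,q) ⟺ (L)_t(p) ∧ (FibAlg)_t(q)` — hom ≡ num for fibre-class multiples gives the lift in the COMPLEMENTARY degree -/

/-- **`(Num₂)(t,q) ⟺ (L)_t(p) ∧ (FibAlg)_t(q)`**, unconditionally (`p + q = d`): "an algebraic class `x ∪ [X_t] ∈ N^{q+1}(𝒳)` cup-orthogonal
to `N^p(𝒳)` vanishes" IS the lift in degree `2p` plus "invariant classes with algebraic fibre-class multiple are algebraic on the fibre".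
`⟹`: the sandwich for `V = B^q = {y ∈ Im j_t^* : j_{t*} y ∈ N^{q+1}(𝒳)}`; `⟸`: `j_t^* x` is invariant algebraic and orthogonal to
`j_t^* N^p(𝒳) = N^p_inv`, hence zero by part XXX-a. (Part XXX-b's `numerical₂_of_fibreClassDivisionAt_of_comap_le_sup` had `Div[t,q]` for
`FibAlg[t,q]`; part XXIX-e's comparison needed `HC^q(X_t)`.) [cite: Kleiman1968AlgebraicCycles, §3 (D(X))] [cite: Lieberman1968, main theorem]
[cite: FultonYoungTableaux1997, Appendix B §B.1 (6)] -/
theorem numerical₂_iff_comap_le_sup_and_fibAlg (hf : IsCompactAbelianPencil f d) (t : ComplexPoints S) {p q : ℕ}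
    (hpq : p + q = d) :
    (∀ x : complexBetti 𝒳 (2 * q),
        fiberGysin hf t q (complexBetti.map (fiberι f t) (2 * q) x) ∈ algebraicClasses 𝒳 (q + 1) →
        (∀ w ∈ algebraicClasses 𝒳 p, cupProduct (show 2 * (q + 1) + 2 * p = 2 * (d + 1) by omega)
            (fiberGysin hf t q (complexBetti.map (fiberι f t) (2 * q) x)) w = 0) →
          fiberGysin hf t q (complexBetti.map (fiberι f t) (2 * q) x) = 0) ↔
      ((algebraicClasses (fiberOver f t) p).comap (complexBetti.map (fiberι f t) (2 * p)).hom ≤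
          algebraicClasses 𝒳 p ⊔ LinearMap.ker (complexBetti.map (fiberι f t) (2 * p)).hom) ∧ FibAlg[hf, t, q] := by
  have hsymm : ∀ (a : complexBetti 𝒳 (2 * p)) (z : complexBetti 𝒳 (2 * (q + 1))),
      cupProduct (show 2 * p + 2 * (q + 1) = 2 * (d + 1) by omega) a z = 0 ↔
        cupProduct (show 2 * (q + 1) + 2 * p = 2 * (d + 1) by omega) z a = 0 := by
    intro a z
    rw [cupProduct_gradedComm_holds ℂ (ComplexPoints 𝒳) (show 2 * p + 2 * (q + 1) = 2 * (d + 1) by omega)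
      (show 2 * (q + 1) + 2 * p = 2 * (d + 1) by omega) a z, smul_eq_zero_iff_right]
    exact pow_ne_zero _ (neg_ne_zero.2 one_ne_zero)
  refine ⟨fun hNum ↦ ?_, fun ⟨hL, hFib⟩ x hx horth ↦ ?_⟩
  · -- the sandwich for `V = B^q`
    set V : Submodule ℂ (complexBetti (fiberOver f t) (2 * q)) :=
      LinearMap.range (complexBetti.map (fiberι f t) (2 * q)).hom ⊓
        (algebraicClasses 𝒳 (q + 1)).comap (fiberGysin hf t q) with hVdef
    have hNV : algebraicClasses (fiberOver f t) q ⊓ LinearMap.range (complexBetti.map (fiberι f t) (2 * q)).hom ≤ V :=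
      fun b hb ↦ ⟨hb.2, fiberGysin_mem_algebraicClasses hf t hb.1⟩
    have hV : ∀ v ∈ V, (∀ a ∈ algebraicClasses 𝒳 p,
        cupProduct (show 2 * p + 2 * q = 2 * d by omega) (complexBetti.map (fiberι f t) (2 * p) a) v = 0) → v = 0 := by
      rintro v ⟨⟨W, hW⟩, hvN⟩ hav
      have hW' : complexBetti.map (fiberι f t) (2 * q) W = v := hW
      have hvN' : fiberGysin hf t q v ∈ algebraicClasses 𝒳 (q + 1) := hvN
      rw [← hW'] at hvN' hav ⊢
      have hjv := hNum W hvN' fun w hw ↦ (hsymm w _).1 ((cupProduct_map_fiberι_eq_zero_iff hf t hpq w _).1 (hav w hw))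
      exact fibreGysinKernelOn_holds hf q t t W hjv
    obtain ⟨hL, hVeq⟩ := sandwich hf t hpq hNV hV
    refine ⟨hL, fun x hx ↦ ?_⟩
    have hxV : complexBetti.map (fiberι f t) (2 * q) x ∈ V := ⟨⟨x, rfl⟩, hx⟩
    rw [hVeq] at hxV
    exact hxV.1
  · -- `j_t^* x` is invariant algebraic, orthogonal to `N^p_inv = j_t^* N^p(𝒳)`
    have hy : complexBetti.map (fiberι f t) (2 * q) x ∈
        algebraicClasses (fiberOver f t) q ⊓ LinearMap.range (complexBetti.map (fiberι f t) (2 * q)).hom := ⟨hFib hx, ⟨x, rfl⟩⟩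
    have hy0 : complexBetti.map (fiberι f t) (2 * q) x = 0 := by
      refine eq_zero_of_forall_cupProduct_eq_zero_of_invariant' hf t hpq hy fun ξ hξ ↦ ?_
      rw [inf_range_eq_map_of_comap_le_sup hf t p hL] at hξ
      obtain ⟨a, ha, rfl⟩ := hξ
      exact (cupProduct_map_fiberι_eq_zero_iff hf t hpq a _).2 ((hsymm a _).2 (horth a ha))
    rw [hy0, map_zero]

/-- **(Num₂)(t,q) ⟹ (L)_t(p)** (`p + q = d`): hom ≡ num for the algebraic fibre-class multiples `x ∪ [X_t]` of degree `2q + 2` on `𝒳` gives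
the LIFT in the complementary degree `2p` — with no parity condition (part XXX-b reached (L)_t(q) from `Div[t,q]` and moved up by hard
Lefschetz for `2q ≤ d` only). [cite: Kleiman1968AlgebraicCycles, §3 (D(X))] [cite: Lieberman1968, main theorem] -/
theorem comap_le_sup_of_numerical₂ (hf : IsCompactAbelianPencil f d) (t : ComplexPoints S) {p q : ℕ} (hpq : p + q = d)
    (hNum : ∀ x : complexBetti 𝒳 (2 * q),
      fiberGysin hf t q (complexBetti.map (fiberι f t) (2 * q) x) ∈ algebraicClasses 𝒳 (q + 1) →
      (∀ w ∈ algebraicClasses 𝒳 p, cupProduct (show 2 * (q + 1) + 2 * p = 2 * (d + 1) by omega)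
          (fiberGysin hf t q (complexBetti.map (fiberι f t) (2 * q) x)) w = 0) →
        fiberGysin hf t q (complexBetti.map (fiberι f t) (2 * q) x) = 0) :
    (algebraicClasses (fiberOver f t) p).comap (complexBetti.map (fiberι f t) (2 * p)).hom ≤
      algebraicClasses 𝒳 p ⊔ LinearMap.ker (complexBetti.map (fiberι f t) (2 * p)).hom :=
  ((numerical₂_iff_comap_le_sup_and_fibAlg hf t hpq).1 hNum).1

/-- **(FibAlg)_t(q) ⟹ (InvProj)_t(q)** (`Π^q ⊆ B^q`: the invariant representative `j_t^* x` of an algebraic `b` has `L_t x = j_{t*} b`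
algebraic, so is algebraic on the fibre). [cite: DeligneHodgeII1971, Thm. 4.1.1] -/
theorem invProj_of_fibAlg (hf : IsCompactAbelianPencil f d) (t : ComplexPoints S) (q : ℕ) (hFib : FibAlg[hf, t, q]) :
    InvProj[hf, t, q] := by
  intro b hb
  obtain ⟨x, hx⟩ := exists_mem_range_fiberGysin_eq hf t q b
  have hxN : x ∈ Submodule.comap ((fiberGysin hf t q) ∘ₗ (complexBetti.map (fiberι f t) (2 * q)).hom)
      (algebraicClasses 𝒳 (q + 1)) := by
    rw [Submodule.mem_comap, LinearMap.comp_apply]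
    change fiberGysin hf t q (complexBetti.map (fiberι f t) (2 * q) x) ∈ _
    rw [hx]
    exact fiberGysin_mem_algebraicClasses hf t hb
  exact ⟨_, ⟨hFib hxN, ⟨x, rfl⟩⟩, hx⟩

/-- **(Num₂)(t,q) ⟹ (Num_t)(p,q)** (`p + q = d`): hom ≡ num for ALL algebraic fibre-class multiples `x ∪ [X_t]` implies it for the Gysin
images `j_{t*} b` of algebraic classes of the fibre (§3, §4 and `Π^q ⊆ B^q`). [cite: Kleiman1968AlgebraicCycles, §3 (D(X))] -/
theorem numerical_of_numerical₂ (hf : IsCompactAbelianPencil f d) (t : ComplexPoints S) {p q : ℕ} (hpq : p + q = d)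
    (hNum : ∀ x : complexBetti 𝒳 (2 * q),
      fiberGysin hf t q (complexBetti.map (fiberι f t) (2 * q) x) ∈ algebraicClasses 𝒳 (q + 1) →
      (∀ w ∈ algebraicClasses 𝒳 p, cupProduct (show 2 * (q + 1) + 2 * p = 2 * (d + 1) by omega)
          (fiberGysin hf t q (complexBetti.map (fiberι f t) (2 * q) x)) w = 0) →
        fiberGysin hf t q (complexBetti.map (fiberι f t) (2 * q) x) = 0) :
    ∀ b ∈ algebraicClasses (fiberOver f t) q,
      (∀ a ∈ algebraicClasses 𝒳 p,
        cupProduct (show 2 * p + 2 * (q + 1) = 2 * (d + 1) by omega) a (fiberGysin hf t q b) = 0) →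
        fiberGysin hf t q b = 0 := by
  obtain ⟨hL, hFib⟩ := (numerical₂_iff_comap_le_sup_and_fibAlg hf t hpq).1 hNum
  exact (numerical_iff_comap_le_sup_and_invProj hf t hpq).2 ⟨hL, invProj_of_fibAlg hf t q hFib⟩

/-! ## §5 The node identity `Num^CM ⟺ (L) ∧ InvProj^CM` -/

/-- **`Num^CM ⟺ (L) ∧ InvProj^CM`**, NO `HC_CM`: part XVIII-c's node `CMPointedPencilNumerical` is EXACTLY the lift node `CMFibreAlgebraicLift`
plus "at every CM point of every compact abelian pencil, every algebraic class of the fibre is Gysin-equivalent to an invariant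
algebraic class" (the surplus is a statement about the CM FIBRE ALONE and its embedding, trivially true under `HC_CM`).
[cite: Kleiman1968AlgebraicCycles, §3 (D(X))] [cite: Andre1996Motifs, §6.3 Remarque 2 (p. 33)] [cite: Milne2020HodgeClassesAV, Prop. 1 (p. 7)] -/
theorem cmPointedPencilNumerical_iff_lift_and_invProjCM :
    CMPointedPencilNumerical ↔ CMFibreAlgebraicLift ∧
      ∀ ⦃d : ℕ⦄ ⦃𝒳 S : SchemeOver ℂ⦄ (f : 𝒳 ⟶ S) (hf : IsCompactAbelianPencil f d), ∀ t ∈ cmLocus f d, ∀ q : ℕ,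
        ∀ b ∈ algebraicClasses (fiberOver f t) q,
          ∃ b' ∈ algebraicClasses (fiberOver f t) q ⊓ LinearMap.range (complexBetti.map (fiberι f t) (2 * q)).hom,
            fiberGysin hf t q b' = fiberGysin hf t q b := by
  refine ⟨fun hNum ↦ ⟨cmFibreAlgebraicLift_iff_numericalInvCM.2 fun _ _ _ f hf t ht p q hpq b hb hab ↦
      hNum f hf t ht p q hpq b hb.1 hab, fun d 𝒳 S f hf t ht q b hb ↦ ?_⟩,
    fun ⟨hL, hInv⟩ d 𝒳 S f hf t ht p q hpq ↦ ?_⟩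
  · rcases le_or_gt q d with hq | hq
    · exact invProj_of_numerical hf t (show (d - q) + q = d by omega) (hNum f hf t ht (d - q) q (by omega)) b hb
    · haveI := subsingleton_complexBetti (hf.isSmoothProjective_fiberOver t) (show 2 * d < 2 * q by omega)
      refine ⟨0, Submodule.zero_mem _, ?_⟩
      rw [Subsingleton.elim b 0]
  · rw [cmFibreAlgebraicLift_iff_comap_le_sup] at hL
    exact (numerical_iff_comap_le_sup_and_invProj hf t hpq).2 ⟨hL f hf p t ht, hInv f hf t ht q⟩

end Summit.HodgeConjecture.HodgeConjecture.Ring2.AbelianAll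

end
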